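import Summits.FinalStateConjecture.FinalStateConjecture.Theses.BartnikGapSettling
import Literature.Geometry.Lorentzian.CollarMargin
import Summits.FinalStateConjecture.FinalStateConjecture.Theorems.GapExhaustion.Negative.GapExhaustionFalseOfFarWildBlackHole

/-!
# Route BartnikGapSettling — crux `GapExhaustion` (stmt-FinalStateConjecture-10808):
# the crux AS TYPED is vacuous modulo junk collars

`GapExhaustion` is an implication whose third hypothesis is the collar-margin clause
(`Literature.Geometry.Lorentzian.Spacetime.CollarMargin`, inlined verbatim in the item): some
`χ₁ < 1`, `k₁`, `δ₁ > 0`, compact `K₁` such that EVERY thick collar chart of EVERY label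
`M₁ > 0`, `|a₁| ≤ M₁`, which is `δ₁`-close in the unweighted `C^{k₁}` norm to boosted Kerr on its
thick slab and late w.r.t. `K₁`, has `|a₁| ≤ χ₁ M₁`. The label `M₁` is not windowed. The line lead
of the sibling crux `GenericCensorshipCollarMargin` (stmt-FinalStateConjecture-10809) isolated the
construction hypothesis `ExtremalJunkCollars` (`Theorems/GenericCensorshipCollarMargin/Negative/
GenericCensorshipCollarMarginFalseOfExtremalJunkCollars.lean`): every MGHD of every admissible datum
carries, at every tolerance `(k₁, δ₁, K₁)`, a chart of EXTREMAL label `a₁ = M₁` meeting all the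
clause's hypotheses (expected by degree-`0` homogeneity of Kerr–Schild, `M₁ → ∞`, and the
Lorentzian one-sided Nash–Kuiper theorem, A. Boukholkhal arXiv:2407.19333v2 Thm 1.2, in far-field
near-flat regions; not constructible in the tree), and proved that it falsifies that crux.

This file records the DUAL consequence for the present crux, as pure logic over the filed text:

* `GapExhaustion_of_forall_not_collarMargin` — if no maximal vacuum Cauchy development of
  admissible data with complete `𝓘⁺` has a collar margin, `GapExhaustion` holds (vacuously: its
  hypothesis is never met). The weakest form of the observation; no construction hypothesis is
  named, so that the file does not depend on the sibling crux's Negative module.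
* `not_hasCollarMargin_of_junkChart` — one junk chart of super-margin label (`χ₁ M₁ < |a₁| ≤ M₁`,
  e.g. the extremal label `a₁ = M₁`) meeting the clause's hypotheses at tolerance `(k₁, δ₁, K₁)`
  refutes `HasCollarMargin χ₁ k₁ δ₁ K₁` for that spacetime — the development-by-development form
  of `not_collarMarginClause_of_junk` of the sibling file, stated over the Literature notion.

Together: wherever junk charts exist at every tolerance (the construction hypothesis
`ExtremalJunkCollars` of the sibling file asserts this for every MGHD of admissible data), the
item's hypothesis fails and the item holds for the wrong reason. This is a certificate that the
item is MISSTATED as filed — the intended dynamical content returns only after the margin clause is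
windowed in the label (`m₀ ≤ M₁ ≤ m₀⁻¹`, the repair recorded in
`Cruxes/GenericCensorshipCollarMargin/MisstatedByMimicry.md` and in this crux's `MISSTATED-c1.md`),
at which point this file proves nothing about the repaired item. The named corollary
`ExtremalJunkCollars → GapExhaustion` is a one-line composition of the two theorems here with
`not_collarMarginClause_of_junk`; it is appended once the sibling module is built on the farm.

Line lead `prover-line-stmt-FinalStateConjecture-10808-c1-0`, 2026-08-16.
-/

noncomputable section

-- D-0017: single-problem summit, `Summit.<S>.<S>.…` by design (cf. lakefile `weak.linter.dupNamespace`).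
set_option linter.dupNamespace false

open Set
open scoped Manifold ENNReal ContDiff Topology

namespace Summit.FinalStateConjecture.FinalStateConjecture.Theorems

open Literature.Geometry.Lorentzian
open Summit.FinalStateConjecture.FinalStateConjecture.Theses.BartnikGapSettling (GapExhaustion)

/-- **Vacuity mechanism, hypothesis-free form.** If no maximal vacuum Cauchy development of
admissible data with complete future null infinity has a collar margin
(`Spacetime.CollarMargin`, by `Iff.rfl` the third hypothesis of the item), then `GapExhaustion`
holds — its hypothesis is never met, so its conclusion is never owed. Pure logic over the filed
text. [folklore] -/
theorem GapExhaustion_of_forall_not_collarMargin :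
    (∀ (X : Type) [TopologicalSpace X] [ChartedSpace E3 X] [IsManifold (𝓡 3) ∞ X]
      [T2Space X] [SecondCountableTopology X] [ConnectedSpace X],
      ∀ D ∈ admissibleVacuumData X, ∀ 𝒟 : VacuumCauchyDevelopment D, 𝒟.IsMaximal →
        Summit.FinalStateConjecture.HasCompleteNullInfinity 𝒟.toCauchyDevelopment →
        ¬ 𝒟.CollarMargin) →
    GapExhaustion := by
  intro h X _ _ _ _ _ _ D hD 𝒟 hmax hcni hcm
  exact absurd hcm (h X D hD 𝒟 hmax hcni)

/-- **Junk charts of super-margin label refute the clause, development by development.** If a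
spacetime `𝓢` carries, for every order `k₁`, size `0 < δ₁` and compact `K₁`, a thick collar chart
of some label `0 < M₁`, `|a₁| ≤ M₁` with `χ₁ * M₁ < |a₁|` meeting every hypothesis of the
collar-margin clause (smooth on and an open embedding of the collar layer, `δ₁`-close in `C^{k₁}`
to boosted Kerr on the thick slab, slab image beyond `J⁻(K₁)`), then `𝓢` has no collar margin of
ratio `χ₁`. The extremal label `a₁ = M₁` serves every `χ₁ < 1` at once. [folklore] -/
theorem not_hasCollarMargin_of_junkChart :
    ∀ (𝓢 : Spacetime.{0} 4) (χ₁ : ℝ) (k₁ : ℕ) (δ₁ : ℝ≥0∞) (K₁ : Set 𝓢.carrier) (M₁ a₁ : ℝ)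
      (mo₁ : lorentzGroup × E4) (B₁ : ModelBackground) (Φ₁ : B₁.domain → 𝓢.carrier),
      0 < M₁ → |a₁| ≤ M₁ → χ₁ * M₁ < |a₁| →
      B₁ = starBackground mo₁.1 mo₁.2 M₁ a₁
        (fun x => Kerr.radius a₁ (poincareInv mo₁.1 mo₁.2 x)) →
      ContMDiffOn 𝓘(ℝ, E4) (𝓡 4) ∞ Φ₁
        {x | -1 < B₁.time x.1 ∧ B₁.time x.1 < 1 ∧ B₁.radius x.1 < 3 * M₁ + 1} →
      Topology.IsOpenEmbedding
        ({x | -1 < B₁.time x.1 ∧ B₁.time x.1 < 1 ∧ B₁.radius x.1 < 3 * M₁ + 1}.restrict Φ₁) →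
      𝓢.truncDeviationCk B₁ Φ₁ k₁ (3 * M₁) 0 ≤ δ₁ →
      Disjoint (Φ₁ '' B₁.truncTimeSlab (3 * M₁) 0)
        (𝓢.metric.causalPast 𝓢.timeOrientation K₁) →
      ¬ 𝓢.HasCollarMargin χ₁ k₁ δ₁ K₁ := by
  intro 𝓢 χ₁ k₁ δ₁ K₁ M₁ a₁ mo₁ B₁ Φ₁ hM₁ ha₁ hχa hB hsm hemb hdev hdisj h
  exact (h M₁ a₁ mo₁ B₁ Φ₁ hM₁ ha₁ hB hsm hemb hdev hdisj).not_gt hχa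

/-! ## Appendix (line lead c5, 2026-08-16): the named corollaries, binder form

The promised compositions, with the construction hypothesis written out: the hypothesis `hJ` of
the three theorems below is VERBATIM the body of
`Theorems.GenericCensorshipCollarMargin.Negative.ExtremalJunkCollars` (sibling Negative module of
crux 10809, p103863), so `ExtremalJunkCollars → GapExhaustion` etc. are these theorems by
`δ`-unfolding; the sibling module is not imported (it is not built on the farm at the time of
writing, as in cycles c3/c4). Content: the named vacuity corollary, and the joint INCONSISTENCY
of the two construction hypotheses filed against this crux — junk collars in every MGHD (the item
holds vacuously, this file) versus one far-wild black-hole development with a margin (the item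
fails, `Theorems/GapExhaustion/Negative/GapExhaustionFalseOfFarWildBlackHole.lean`, p108531).
Exactly one of them is true; which one is far-field bookkeeping (`Cruxes/GapExhaustion/
ADDENDUM-c2.md`, `AUDIT-c4.md` §3): on far-wild data no late region is `C³`-quiet, so the junk
hypothesis (all orders, all data) is the one expected to fail, at `k₁ ≥ 3`. -/

/-- **No development has a collar margin, modulo junk collars** (binder form; `hJ` is verbatim
the body of `ExtremalJunkCollars`): if every maximal vacuum Cauchy development of every admissible
datum carries, at every tolerance `(k₁, δ₁, K₁)`, a thick collar chart of EXTREMAL label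
`a₁ = M₁ > 0` meeting the hypotheses of the collar-margin clause, then no such development has a
collar margin (`Spacetime.CollarMargin`, the clause by `Iff.rfl`): the clause at its own
tolerance would give `M₁ = |a₁| ≤ χ₁ M₁ < M₁`. [folklore] -/
theorem not_collarMargin_of_junkCollars
    (hJ : ∀ (X : Type) [TopologicalSpace X] [ChartedSpace E3 X] [IsManifold (𝓡 3) ∞ X]
      [T2Space X] [SecondCountableTopology X] [ConnectedSpace X],
      ∀ D ∈ admissibleVacuumData X, ∀ 𝒟 : VacuumCauchyDevelopment D, 𝒟.IsMaximal →
        ∀ (k₁ : ℕ) (δ₁ : ℝ≥0∞) (K₁ : Set 𝒟.carrier), 0 < δ₁ → IsCompact K₁ →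
          ∃ (M₁ : ℝ) (mo₁ : lorentzGroup × E4) (B₁ : ModelBackground)
            (Φ₁ : B₁.domain → 𝒟.carrier),
            0 < M₁ ∧
            B₁ = starBackground mo₁.1 mo₁.2 M₁ M₁
              (fun x => Kerr.radius M₁ (poincareInv mo₁.1 mo₁.2 x)) ∧
            ContMDiffOn 𝓘(ℝ, E4) (𝓡 4) ∞ Φ₁
              {x | -1 < B₁.time x.1 ∧ B₁.time x.1 < 1 ∧ B₁.radius x.1 < 3 * M₁ + 1} ∧
            Topology.IsOpenEmbedding
              ({x | -1 < B₁.time x.1 ∧ B₁.time x.1 < 1 ∧ B₁.radius x.1 < 3 * M₁ + 1}.restrict Φ₁) ∧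
            𝒟.toSpacetime.truncDeviationCk B₁ Φ₁ k₁ (3 * M₁) 0 ≤ δ₁ ∧
            Disjoint (Φ₁ '' B₁.truncTimeSlab (3 * M₁) 0)
              (𝒟.metric.causalPast 𝒟.timeOrientation K₁)) :
    ∀ (X : Type) [TopologicalSpace X] [ChartedSpace E3 X] [IsManifold (𝓡 3) ∞ X]
      [T2Space X] [SecondCountableTopology X] [ConnectedSpace X],
      ∀ D ∈ admissibleVacuumData X, ∀ 𝒟 : VacuumCauchyDevelopment D, 𝒟.IsMaximal →
        ¬ 𝒟.CollarMargin := by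
  intro X _ _ _ _ _ _ D hD 𝒟 hmax hcm
  obtain ⟨χ₁, k₁, δ₁, K₁, hχ₁, hδ₁, hK₁, hm⟩ := hcm
  obtain ⟨M₁, mo₁, B₁, Φ₁, hM₁, hB, hsm, hemb, hdev, hdisj⟩ := hJ X D hD 𝒟 hmax k₁ δ₁ K₁ hδ₁ hK₁
  exact not_hasCollarMargin_of_junkChart 𝒟.toSpacetime χ₁ k₁ δ₁ K₁ M₁ M₁ mo₁ B₁ Φ₁ hM₁
    (abs_of_pos hM₁).le (by rw [abs_of_pos hM₁]; nlinarith) hB hsm hemb hdev hdisj hm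

/-- **`GapExhaustion` modulo junk collars** (the named corollary promised in the module
docstring, binder form; `hJ` verbatim the body of `ExtremalJunkCollars`): by
`GapExhaustion_of_forall_not_collarMargin` — the item then holds for the wrong reason, its
hypothesis being never met. [folklore] -/
theorem GapExhaustion_of_junkCollars
    (hJ : ∀ (X : Type) [TopologicalSpace X] [ChartedSpace E3 X] [IsManifold (𝓡 3) ∞ X]
      [T2Space X] [SecondCountableTopology X] [ConnectedSpace X],
      ∀ D ∈ admissibleVacuumData X, ∀ 𝒟 : VacuumCauchyDevelopment D, 𝒟.IsMaximal →
        ∀ (k₁ : ℕ) (δ₁ : ℝ≥0∞) (K₁ : Set 𝒟.carrier), 0 < δ₁ → IsCompact K₁ →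
          ∃ (M₁ : ℝ) (mo₁ : lorentzGroup × E4) (B₁ : ModelBackground)
            (Φ₁ : B₁.domain → 𝒟.carrier),
            0 < M₁ ∧
            B₁ = starBackground mo₁.1 mo₁.2 M₁ M₁
              (fun x => Kerr.radius M₁ (poincareInv mo₁.1 mo₁.2 x)) ∧
            ContMDiffOn 𝓘(ℝ, E4) (𝓡 4) ∞ Φ₁
              {x | -1 < B₁.time x.1 ∧ B₁.time x.1 < 1 ∧ B₁.radius x.1 < 3 * M₁ + 1} ∧
            Topology.IsOpenEmbedding
              ({x | -1 < B₁.time x.1 ∧ B₁.time x.1 < 1 ∧ B₁.radius x.1 < 3 * M₁ + 1}.restrict Φ₁) ∧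
            𝒟.toSpacetime.truncDeviationCk B₁ Φ₁ k₁ (3 * M₁) 0 ≤ δ₁ ∧
            Disjoint (Φ₁ '' B₁.truncTimeSlab (3 * M₁) 0)
              (𝒟.metric.causalPast 𝒟.timeOrientation K₁)) :
    GapExhaustion :=
  GapExhaustion_of_forall_not_collarMargin fun X _ _ _ _ _ _ D hD 𝒟 hmax _ =>
    not_collarMargin_of_junkCollars hJ X D hD 𝒟 hmax

/-- **The two construction hypotheses filed against the crux are jointly inconsistent**: junk
collars everywhere (`hJ`, verbatim `ExtremalJunkCollars`) give `GapExhaustion` (vacuously), while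
`FarWildBlackHoleExists` gives `¬ GapExhaustion` (`GapExhaustion_false_of_farWildBlackHoleExists`,
p108531) — equivalently, the far-wild witness development has a collar margin
(`exists_collarMargin_of_farWildBlackHoleExists`), which junk collars forbid. Bookkeeping for the
negatives index: at most one of the two can ever be discharged. [folklore] -/
theorem not_farWildBlackHoleExists_of_junkCollars
    (hJ : ∀ (X : Type) [TopologicalSpace X] [ChartedSpace E3 X] [IsManifold (𝓡 3) ∞ X]
      [T2Space X] [SecondCountableTopology X] [ConnectedSpace X],
      ∀ D ∈ admissibleVacuumData X, ∀ 𝒟 : VacuumCauchyDevelopment D, 𝒟.IsMaximal →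
        ∀ (k₁ : ℕ) (δ₁ : ℝ≥0∞) (K₁ : Set 𝒟.carrier), 0 < δ₁ → IsCompact K₁ →
          ∃ (M₁ : ℝ) (mo₁ : lorentzGroup × E4) (B₁ : ModelBackground)
            (Φ₁ : B₁.domain → 𝒟.carrier),
            0 < M₁ ∧
            B₁ = starBackground mo₁.1 mo₁.2 M₁ M₁
              (fun x => Kerr.radius M₁ (poincareInv mo₁.1 mo₁.2 x)) ∧
            ContMDiffOn 𝓘(ℝ, E4) (𝓡 4) ∞ Φ₁
              {x | -1 < B₁.time x.1 ∧ B₁.time x.1 < 1 ∧ B₁.radius x.1 < 3 * M₁ + 1} ∧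
            Topology.IsOpenEmbedding
              ({x | -1 < B₁.time x.1 ∧ B₁.time x.1 < 1 ∧ B₁.radius x.1 < 3 * M₁ + 1}.restrict Φ₁) ∧
            𝒟.toSpacetime.truncDeviationCk B₁ Φ₁ k₁ (3 * M₁) 0 ≤ δ₁ ∧
            Disjoint (Φ₁ '' B₁.truncTimeSlab (3 * M₁) 0)
              (𝒟.metric.causalPast 𝒟.timeOrientation K₁)) :
    ¬ GapExhaustion.Negative.FarWildBlackHoleExists := fun H =>
  GapExhaustion.Negative.GapExhaustion_false_of_farWildBlackHoleExists H
    (GapExhaustion_of_junkCollars hJ)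

end Summit.FinalStateConjecture.FinalStateConjecture.Theorems

end
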